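/-
Copyright (c) 2026 the pub-hodgecm-mathlib formalisation cell (harness21).  Prover seat hodgecm-mathlib-K2E1b-p14 (g0),
Track B «K2-LIT» ∕ h413, unit U5 «PINS + ROW 10» of the line `K2_E1b_GKCohomologyU21`, file #16: payment of the socket
`K2E1bGKCohomologyU21.U456.sig_K2E1bArchDegOneClassChi` — THE CLASS OF RECORD `[J^δ]` IS χ-PINNED AT `(κ, e) = (0, 0)`.  2026-09-03.
-/
import Summits.HodgeConjecture.HodgeConjecture.Theorems.F0P3bArchDegOneClass        -- ★ `archDegOneClass`, `archDegOneClass_spec` (X1′), ★ `GKIrrep` ∕ `GKIrrClass.mk`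
import Summits.HodgeConjecture.HodgeConjecture.Theorems.F0P3cWignerCasimirCentral   -- ★ W3∕W4 `wχ_casimir_and_central_eq_zero_of_typeClasses_ne_bot` (Schur + W1∕W2)
import Summits.HodgeConjecture.HodgeConjecture.Theorems.K2E1bGKCohomologyU21Defs    -- ★ tier-0 defs leaf (p854739): `HasChiScalars`, `IsChiPinnedCohUnitary`
import HarnessLib

/-!
# K2_E1b road (h413 = stmt-HodgeConjecture-24833), unit U5, file #16:
# the archimedean `H¹`-class of record `archDegOneClass δ` has Casimir scalar `0` and central scalar `0`

Cell `pub/hodgecm-mathlib` (D-0151), Track B (21-frontier RULING «PUSH BOTH» 2026-09-03, director req621∕req624, chair K2-lead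
ORDER #1 §4.4 ∕ ORDER #2, SKELETON LANDED K2E1b 2026-09-03T20:54:44Z), socket module
`Summits/HodgeConjecture/HodgeConjecture/Cruxes/H413/Lines/K2_E1b_GKCohomologyU21_U456_Cohomology.lean` (planner K2E1b-plan (g0),
sha16 a11d6b21314447a9), socket **`sig_K2E1bArchDegOneClassChi`** (#16, size S–M, JUNCTION J1 service; the `(0,0)`-row of tier 0's
`IsChiPinnedCohUnitary (archDegOneClass δ) 0 0`, UNFOLDED).

THE MATHEMATICS [BorelWallach2000, I Thm. 5.3 (ii); II Cor. 3.3] [Rogawski1990, Prop. 15.2.1 (b) p. 249].  The ★ class of record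
`archDegOneClass δ hδ : GKIrrClass U(2,1)` (X1′, ★ `F0P3bArchDegOneClass`) is, by ★ `archDegOneClass_spec`, the class `GKIrrClass.mk r` of a
bundled irreducible `(𝔲(2,1), K)`-module `r` which is unitary cohomological (★ `IsCohUnitaryIrrep r.ρK r.ρ𝔤`) with a NON-ZERO degree-one
class space `upqTypeClasses … 1 δ ≠ ⊥`.  Wigner's lemma in χ-currency, paid in the tree as ★ `F0P3cWignerCasimirCentral.
wχ_casimir_and_central_eq_zero_of_typeClasses_ne_bot` (Dixmier–Schur: on an irreducible module the trace-form Casimir ★ `upqCasimirOp` and every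
scalar element `Z = a·1 ∈ 𝔲(2,1)` act by scalars [KnappVogan1995, Prop. 4.87]; a NON-ZERO Casimir scalar kills every `upqTypeClasses`
[BW II Cor. 3.3, ★ W1 `upqTypeClasses_eq_bot_of_upqCasimirOp_eq_smul`], and so does a non-zero central scalar [BW I Thm. 5.3 (ii), ★ W2
`upqTypeClasses_eq_bot_of_center_eq_smul`]), then says: the Casimir acts by `0` on `r.V` and every `Z` with `↑Z = i·1` acts by `0` — which are
the socket's two clauses with the scalars spelled `((0 : ℤ) : ℂ)` and `((0 : ℤ) : ℂ) * I` (`Int.cast_zero`, `zero_mul`, `zero_smul`).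

* §1 **`archDegOneClassChi`** — `sig_K2E1bArchDegOneClassChi` TOKEN FOR TOKEN (BY-NAME tie checked at home against the BUILT socket module:
  `example : type_of% @archDegOneClassChi = type_of% @K2E1bGKCohomologyU21.U456.sig_K2E1bArchDegOneClassChi := rfl`,
  `K2/K2E1b-p14/g0/Probe_K2E1bArchDegOneClassChi.lean`, rc 0);
* §2 `archDegOneClassChi_zero` — the same with the scalars normalised (`upqCasimirOp r.ρ𝔤 v = 0`, `r.ρ𝔤 Z v = 0`; the form ★ W1∕W2-consumers
  and the Wigner assembly #19 read);
* §3 `hasChiScalars_zero_zero_of_typeClasses_ne_bot` (any bundled irreducible module with a non-zero `upqTypeClasses` has χ-scalars `(0, 0)`) and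
  **`isChiPinnedCohUnitary_archDegOneClass_zero_zero`** — the pin in tier 0's OWN currency (★ defs leaf `K2E1bGKCohomologyU21Defs`):
  `IsChiPinnedCohUnitary (archDegOneClass δ hδ) 0 0`, the `(κ, e) = (0, 0)` row the assembly files `stub_jTable` ∕ `stub_dsTable` consume at the
  cohomologically trivial parameters.

No local instance attribute is needed here: every `ρ𝔤` mentioned is the field `GKIrrep.ρ𝔤` of a bundle, whose type is already elaborated.

WHAT IS NOT HERE.  The integrality∕value of the χ-scalars on the OTHER members of the §12.3 table (`κ(φ) = a²+b²+c²−2`, `e(φ) = a+b+c` — tier 0's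
`stub_jTable` ∕ `stub_dsTable`), and the class-level transport of `= ⊥` (#15 `sig_K2E1bTypeClassesBotTransport`).

HONEST LABEL.  HC_CM is proved only modulo the 7 printed citations (2 remaining named inputs: hLiu418 = `stmt-HodgeConjecture-24832`, h413 =
`stmt-HodgeConjecture-24833`) until rung 0 closes; this file is a `--supports stmt-HodgeConjecture-24833` helper and moves no counter.

## References
* [BorelWallach2000] A. Borel, N. Wallach, *Continuous Cohomology, Discrete Subgroups, and Representations of Reductive Groups*, 2nd ed.,
  Math. Surveys Monogr. 67, AMS (2000) — I Thm. 5.3 (ii) (central character), II Cor. 3.2–3.3 (Casimir criterion), VI Thm. 4.11.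
* [Rogawski1990] J. D. Rogawski, *Automorphic Representations of Unitary Groups in Three Variables*, Ann. of Math. Stud. 123 (1990) —
  §12.3 p. 178 (`J^±_φ`), Prop. 15.2.1 (b) p. 249 (the unitary cohomological representations with `H¹ ≠ 0`).
* [KnappVogan1995] A. W. Knapp, D. A. Vogan, *Cohomological Induction and Unitary Representations*, Princeton (1995) — Prop. 4.87 (Dixmier's lemma).
-/

set_option autoImplicit false
-- the mandated namespace repeats the single-problem summit's segment (`HodgeConjecture.HodgeConjecture`)
set_option linter.dupNamespace false

noncomputable section

namespace Summit.HodgeConjecture.HodgeConjecture.Cruxes.H413.K2E1bArchDegOneClassChi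

open Literature.NumberTheory.Automorphic
open Literature.RepresentationTheory
open Literature.RepresentationTheory.BorelWallach2000
open Literature.RepresentationTheory.KonnoKonno2007 Literature.RepresentationTheory.KonnoKonno2007.RealDualPair
open Literature.RepresentationTheory.KonnoKonno2007.RealDualPair.UForm
open Summit.HodgeConjecture.HodgeConjecture.Cruxes.H413.F0P3bLocalAPacketsDefs
open Summit.HodgeConjecture.HodgeConjecture.Cruxes.H413.F0P3bArchDegOnePackage (IsCohUnitaryIrrep)
open Summit.HodgeConjecture.HodgeConjecture.Cruxes.H413.F0P3bArchDegOneClass (archDegOneClass archDegOneClass_spec)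
open Summit.HodgeConjecture.HodgeConjecture.Cruxes.H413.F0P3cWignerCasimirCentral (wχ_casimir_and_central_eq_zero_of_typeClasses_ne_bot)
open Summit.HodgeConjecture.HodgeConjecture.Cruxes.H413.K2E1bGKCohomologyU21 (HasChiScalars IsChiPinnedCohUnitary)

/-! ## §1 The head -/

/-- **PAYMENT OF `sig_K2E1bArchDegOneClassChi`** (socket #16 of unit U5 of the K2_E1b road,
`Cruxes/H413/Lines/K2_E1b_GKCohomologyU21_U456_Cohomology.lean`, TOKEN FOR TOKEN): the ★ class of record `archDegOneClass δ` (`[J^δ_{φ₀}]`,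
X1′) is χ-PINNED AT `(κ, e) = (0, 0)` — its representative of record (★ `archDegOneClass_spec`: irreducible, unitary cohomological, `H¹_δ ≠ ⊥`)
has Casimir scalar `0` and central scalar `0` by Wigner's lemma in χ-currency (★ W4 `wχ_casimir_and_central_eq_zero_of_typeClasses_ne_bot`:
Dixmier–Schur read-backs + the contrapositives of ★ W1∕W2), the zeros re-spelled as `((0 : ℤ) : ℂ) • v` and `(((0 : ℤ) : ℂ) * I) • v`.
[cite: BorelWallach2000, I Thm. 5.3 (ii); II Cor. 3.3] [cite: Rogawski1990, Prop. 15.2.1 (b) p. 249] [cite: KnappVogan1995, Prop. 4.87] -/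
theorem archDegOneClassChi :
    ∀ (δ : ℤ) (hδ : δ = 1 ∨ δ = -1), ∃ r : GKIrrep G21, GKIrrClass.mk r = archDegOneClass δ hδ ∧ IsCohUnitaryIrrep r.ρK r.ρ𝔤 ∧
      (∀ v : r.V, upqCasimirOp r.ρ𝔤 v = (((0 : ℤ) : ℂ)) • v) ∧
        ∀ Z : G21.lie, (Z : Matrix (Fin 2 ⊕ Fin 1) (Fin 2 ⊕ Fin 1) ℂ) = Complex.I • (1 : Matrix (Fin 2 ⊕ Fin 1) (Fin 2 ⊕ Fin 1) ℂ) →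
          ∀ v : r.V, r.ρ𝔤 Z v = (((0 : ℤ) : ℂ) * Complex.I) • v := by
  intro δ hδ
  obtain ⟨r, h, hne, hr⟩ := archDegOneClass_spec δ hδ
  obtain ⟨hC, hZ⟩ := wχ_casimir_and_central_eq_zero_of_typeClasses_ne_bot h.gk h.irred hne
  refine ⟨r, hr, h, fun v => ?_, fun Z hZ' v => ?_⟩
  · rw [hC v, Int.cast_zero, zero_smul]
  · rw [hZ Z Complex.I hZ' v, Int.cast_zero, zero_mul, zero_smul]

/-! ## §2 Normalised read-back -/

/-- **The same pin with the scalars normalised**: the representative of record of `archDegOneClass δ` has `upqCasimirOp = 0` pointwise and every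
`Z` with `↑Z = i·1` acts by `0` (★ W4 at the representative of ★ `archDegOneClass_spec`).
[cite: BorelWallach2000, I Thm. 5.3 (ii); II Cor. 3.3] [cite: Rogawski1990, Prop. 15.2.1 (b) p. 249] -/
theorem archDegOneClassChi_zero (δ : ℤ) (hδ : δ = 1 ∨ δ = -1) :
    ∃ r : GKIrrep G21, GKIrrClass.mk r = archDegOneClass δ hδ ∧ IsCohUnitaryIrrep r.ρK r.ρ𝔤 ∧
      (∀ v : r.V, upqCasimirOp r.ρ𝔤 v = 0) ∧
        ∀ Z : G21.lie, (Z : Matrix (Fin 2 ⊕ Fin 1) (Fin 2 ⊕ Fin 1) ℂ) = Complex.I • (1 : Matrix (Fin 2 ⊕ Fin 1) (Fin 2 ⊕ Fin 1) ℂ) →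
          ∀ v : r.V, r.ρ𝔤 Z v = 0 := by
  obtain ⟨r, h, hne, hr⟩ := archDegOneClass_spec δ hδ
  obtain ⟨hC, hZ⟩ := wχ_casimir_and_central_eq_zero_of_typeClasses_ne_bot h.gk h.irred hne
  exact ⟨r, hr, h, hC, fun Z hZ' => hZ Z Complex.I hZ'⟩

/-! ## §3 The pin in tier 0's currency (`HasChiScalars`, `IsChiPinnedCohUnitary`) -/

/-- **χ-scalars `(0, 0)` of a bundled irreducible module with cohomology**: a ★ `GKIrrep G21` with some `upqTypeClasses … n δ ≠ ⊥` has
★ `HasChiScalars r.ρ𝔤 0 0` (Casimir `0`, centre `0·i`) — ★ W4 re-spelled in the tier-0 predicate.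
[cite: BorelWallach2000, I Thm. 5.3 (ii); II Cor. 3.3] [cite: KnappVogan1995, Prop. 4.87] -/
theorem hasChiScalars_zero_zero_of_typeClasses_ne_bot (r : GKIrrep G21) {n : ℕ} {δ : ℤ}
    (hne : upqTypeClasses r.ρK r.ρ𝔤 r.isGKModule.ad_compat n δ ≠ ⊥) : HasChiScalars r.ρ𝔤 0 0 := by
  obtain ⟨hC, hZ⟩ := wχ_casimir_and_central_eq_zero_of_typeClasses_ne_bot r.isGKModule r.isIrreducible hne
  refine ⟨fun v => ?_, fun Z hZ' v => ?_⟩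
  · rw [hC v, Int.cast_zero, zero_smul]
  · rw [hZ Z Complex.I hZ' v, Int.cast_zero, zero_mul, zero_smul]

/-- **THE `(0, 0)` ROW OF TIER 0**: `IsChiPinnedCohUnitary (archDegOneClass δ hδ) 0 0` — the ★ class of record `[J^δ]` is χ-pinned at
`(κ, e) = (0, 0)` in the currency of the line `K2_E1b_GKCohomologyU21` (★ defs leaf `K2E1bGKCohomologyU21Defs`); this is §1 folded back into the
predicate (the representative of ★ `archDegOneClass_spec` witnesses it), the row the assembly stubs `stub_jTable` ∕ `stub_dsTable` use at the
cohomologically trivial parameters (`casimirExp = 0`, `centralExp = 0`).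
[cite: BorelWallach2000, I Thm. 5.3 (ii); II Cor. 3.3] [cite: Rogawski1990, Prop. 15.2.1 (b) p. 249; §12.3 p. 178] -/
theorem isChiPinnedCohUnitary_archDegOneClass_zero_zero (δ : ℤ) (hδ : δ = 1 ∨ δ = -1) :
    IsChiPinnedCohUnitary (archDegOneClass δ hδ) 0 0 := by
  obtain ⟨r, hr, h, hC, hZ⟩ := archDegOneClassChi δ hδ
  exact ⟨r, hr, h, hC, hZ⟩

end Summit.HodgeConjecture.HodgeConjecture.Cruxes.H413.K2E1bArchDegOneClassChi

end
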